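/-
Copyright (c) 2026 the pub-hodgecm-mathlib formalisation cell (harness21).  R90-TF SLAB, section S10 (Rogawski 1990, §13.6–13.8 read at `v`),
prover R90-C138-p08 (g0) — DEAL #20-b (R90-C138-plan (g3) 2026-09-05T01:24:01Z ∕ 01:33:16Z, RULING J-M3-5), the (M-b′) PAYER OF RECORD; h413 = `stmt-HodgeConjecture-24833`,
route `HCCMUnconditional`.
-/
import Summits.HodgeConjecture.HodgeConjecture.Theorems.R90S10SplitAbstractTransferCore          -- this seat, step 2∕2: `exists_admissible_smoothTrace_eq_cmSplitTransfer_of_equiv_cmPrincipalSeriesH`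
import Summits.HodgeConjecture.HodgeConjecture.Theorems.R90S10PSLocalCharTransferAbstractLetters  -- ★ p01 (g0) DEAL #20-a: (M-b′) `SplitAbstractTransferLetter` (bytes of record = p06 (g0)'s GUESS 7ae495bb)
import HarnessLib

/-!
# R90-TF ∕ S10 — (M-b′) `SplitAbstractTransferLetter L μ w νQw νHw` HOLDS (the split-place abstract transfer, RULING J-M3-5 road of record)
# (`Theorems/R90S10SplitAbstractTransfer.lean`; ns `Summit.HodgeConjecture.HodgeConjecture.R90.S10`; LAW L9: ★ `Theorems` imports only; ONE THEOREM — no `def`, no instance,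
# no notation, no `sorry`)

Print: [Rogawski1990] §4.13 Lemma 4.13.1 (b) pp. 64–66 («if `v` splits … `Tr i_G(σ̃)(f) = Tr σ(τ_v · f̄^P)`»), §13.8 p. 217; [vanDijk1972] Thm. p. 237; [BernsteinZelevinsky1977] Prop. 2.3.

## WHAT THIS FILE PROVES
`splitAbstractTransferLetter_holds … : SplitAbstractTransferLetter L μ w νQw νHw` — p01 (g0)'s ★ letter (M-b′) (`Theorems/R90S10PSLocalCharTransferAbstractLetters.lean`), i.e.
for every `W ∣ w` with `c • W ≠ W`, every inducing pair `(χ₂, χ₁)` (`χ₁` with open kernel) and every realisation `ρ_w ≅ i_H(χ₂ ⊠ χ₁)` there is an ADMISSIBLE `I` on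
`G_w = U(Φ₃)(L⁺_w)` with `Tr I(φ; νQw) = Tr ρ_w(τ_w · φ̄^P; νHw)` for all `φ ∈ C_c^∞(G_w)` — by ★ `exists_admissible_smoothTrace_eq_cmSplitTransfer_of_equiv_cmPrincipalSeriesH`
(`Theorems/R90S10SplitAbstractTransferCore.lean`: `I := i_c(σ′) ∘ e′`, ★ J1-adm + ★ VD + ★ J2), `intro` + `exact`, token for token against the letter's binders.
CONSUMER: p06 (g0)'s FILE 2′ `Theorems/R90S10PSLocalCharTransferAbstractSplit.lean :: localCharTransferAbstract_of_split (hA) (hB′ := splitAbstractTransferLetter_holds …) …`.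
HONEST LABEL: discharges the named input (M-b′) of the split-place payer of letter (3′); (M-a) `SplitHVanDijkLetter` remains p03 (g2)'s; pays no socket by itself;
HC_CM is proved only modulo the 7 printed citations (2 remaining named inputs: hLiu418 = `stmt-HodgeConjecture-24832`, h413 = `stmt-HodgeConjecture-24833`) until rung 0 closes;
REL ≠ ★ ≠ BUILT.
-/

set_option autoImplicit false
set_option linter.dupNamespace false

noncomputable section

namespace Summit.HodgeConjecture.HodgeConjecture.R90.S10

open MeasureTheory NumberField
open Literature.NumberTheory.Rogawski1990 Literature.NumberTheory.Automorphic Literature.NumberTheory.Automorphic.UnitaryGroup Literature.NumberTheory.GaloisRepresentations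
open Summit.HodgeConjecture.HodgeConjecture.Cruxes.H413.K2E1TraceFormulaBeta

/-- **(M-b′) HOLDS — the split-place abstract transfer** `SplitAbstractTransferLetter L μ w νQw νHw`: at `W ∣ w` split, for every `(χ₂, χ₁)` with `ker χ₁` open and every
`ρ_w ≅ i_H(χ₂ ⊠ χ₁)`, `∃ I` admissible on `U(Φ₃)(L⁺_w)` with `Tr I(φ) = Tr ρ_w(τ_w · φ̄^P)` (★ `cmSplitTransfer`) for all `φ ∈ C_c^∞` — `I = i_{(2,1)}((ρ_w ⊗ χ) ∘ Θ⁻¹) ∘ e′`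
by ★ `exists_admissible_smoothTrace_eq_cmSplitTransfer_of_equiv_cmPrincipalSeriesH`. [cite: Rogawski1990, §4.13 Lemma 4.13.1 (b) pp. 64–66; §13.8 p. 217]
[cite: vanDijk1972, Thm. p. 237] [cite: BernsteinZelevinsky1977, Prop. 2.3] -/
theorem splitAbstractTransferLetter_holds (L : Type) [Field L] [NumberField L] [IsCMField L] (μ : HeckeCharacter L) (w : Pl L)
    {_msH : MeasurableSpace (HLoc L w)} {_msG : MeasurableSpace (Gqs L w)} [BorelSpace (HLoc L w)] [BorelSpace (Gqs L w)]
    (νQw : Measure (Gqs L w)) (νHw : Measure (HLoc L w)) [νQw.IsHaarMeasure] [νHw.IsHaarMeasure] :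
    SplitAbstractTransferLetter L μ w νQw νHw := by
  intro W hW χ₂ χ₁ hχ₁ Vw _ _ ρw hρ
  exact exists_admissible_smoothTrace_eq_cmSplitTransfer_of_equiv_cmPrincipalSeriesH L μ w νQw νHw W hW χ₂ χ₁ hχ₁ ρw hρ

end Summit.HodgeConjecture.HodgeConjecture.R90.S10

end
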